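import Mathlib

/-!
# The cell `(3,4)` in the kernel, I: THE CHECKER — `patternForm 3 4 ≥ 0` on all `4 424 940 417` coloured antichains of `[4]^3`,
# evaluated on the `40 238` axis-canonical antichains × restricted-growth colourings (`36 017 202` saturated families)

Support file of the one-cut programme (crux `NoHeavyLowerTail`, stmt-CriticalPhenomena-4575; cell `prim-masterthm`, seat P3, gen 19;
`run/shared/lean/prim/prim-masterthm/prim-masterthm-p3/HIERARCHY.md` §27).  COMPUTATIONAL (the shard files decide `checkRange lo n = true` by
`native_decide`); this file holds the definitions and small sanity checks only.

WHAT IS COMPUTED.  Cells of the slot cube `[4]^3` are the numbers `c = 16x + 4y + z < 64`; a family of four members is held through the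
DOWN-SET MASKS `d_i` of the complements (`U_i = [4]^3 ∖ ↓N_i`).  The `576 = 24²` Latin transversals `L = {(j, αj, βj) : j < 4}` (four cells,
pairwise distinct in every coordinate) carry the 16-bit incidence pattern `M_L` (bit `4i+j` = `[cell j of L ∈ U_i]`), and
  `Φ(U) = Σ_L Ψ(M_L)`,  `Ψ(M) = Σ_{ρ ∈ S_4} K₄(M ∘ ρ)`,
with `K₄` the order-4 copy kernel in the closed form of prim-sahi's `SahiGridPatternN.copyKernel_four` — so that `Φ(U) = sStarN 4 3 U`
(`= patternForm 3 4 (1_U)` by P3's `sStarN_cast_eq_patternForm`; the identification is the companion file `…SahiSlotCell34Ident`).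
Removing ONE cell `y` from member `i` changes only bit `(i, pos)` of the `36` patterns through `y`, so `Φ` is maintained along the depth-first
enumeration of the colourings of an antichain `N = {p_1, …, p_k}` (member `i` loses `↓p_j ∖ ↓N_i^{so far}` when `p_j` gets colour `i`) at the cost of
`36` table look-ups per removed cell (`ctTab[M][b] = Ψ(M) − Ψ(M − 2^b)`).  Colourings are enumerated up to the colour symmetry `S_4`
(restricted growth: colour of `p_j` ≤ number of colours already used) and antichains up to the axis symmetry `S_3` (`isCanon`: minimal mask in
its orbit); both symmetries are undone in the companion files (`patternForm_perm_slots`, `patternForm_comp_axisPerm`).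
`checkRange lo n` runs the canonical antichains with indices `lo ≤ a < lo + n` (of `40 238`) and demands `Φ ≥ 0` at every leaf.
External replay (seat C engine, 19 s): 36 017 202 leaves, 0 negatives, `Φ = 0` only when a member is the whole cube, `min Φ = 576` otherwise —
the sixth exact implementation of typer gen 27's census (HOME/prim-masterthm-p3/code-g19/proto34.c).
HONEST LABEL: definitions + sanity checks; nothing is asserted about `(3,4)` in this file. [this work]
-/

namespace Summit.CriticalPhenomena.PercolationContinuityZ3.Theorems

namespace SahiSlot34

/-! ### Bit vectors -/

/-- The number with the given bits below `k`. [this work] -/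
def ofBits (f : ℕ → Bool) : ℕ → ℕ
  | 0 => 0
  | k + 1 => ofBits f k + 2 ^ k * (f k).toNat

/-- `ofBits f k < 2^k`. [this work] -/
theorem ofBits_lt (f : ℕ → Bool) : ∀ k, ofBits f k < 2 ^ k
  | 0 => by simp [ofBits]
  | k + 1 => by
    have ih := ofBits_lt f k
    have hb : (f k).toNat ≤ 1 := by cases f k <;> simp
    unfold ofBits
    calc ofBits f k + 2 ^ k * (f k).toNat < 2 ^ k + 2 ^ k * 1 := by
          have := Nat.mul_le_mul_left (2 ^ k) hb; omega
      _ = 2 ^ (k + 1) := by rw [pow_succ]; ring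

/-- The bits of `ofBits`. [this work] -/
theorem testBit_ofBits (f : ℕ → Bool) : ∀ k i, (ofBits f k).testBit i = (decide (i < k) && f i)
  | 0, i => by simp [ofBits]
  | k + 1, i => by
    unfold ofBits
    rw [add_comm, Nat.testBit_two_pow_mul_add _ (ofBits_lt f k), testBit_ofBits f k]
    split_ifs with hi
    · simp [hi, Nat.lt_succ_of_lt hi]
    · rw [Nat.testBit_bool_toNat]
      rcases Nat.eq_or_lt_of_le (not_lt.1 hi) with h | h
      · subst h; simp
      · have h1 : ¬ (i - k = 0) := by omega
        have h2 : ¬ (i < k + 1) := by omega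
        simp [h1, h2]

/-! ### Cells of `[4]^3` -/

/-- `x`-coordinate of the cell `c = 16x + 4y + z`. [this work] -/
def cx (c : ℕ) : ℕ := c / 16
/-- `y`-coordinate. [this work] -/
def cy (c : ℕ) : ℕ := c / 4 % 4
/-- `z`-coordinate. [this work] -/
def cz (c : ℕ) : ℕ := c % 4
/-- The product order on cells. [this work] -/
def cle (c d : ℕ) : Bool := decide (cx c ≤ cx d) && (decide (cy c ≤ cy d) && decide (cz c ≤ cz d))
/-- Mask of the principal down-set `↓p`. [this work] -/
def downMask (p : ℕ) : ℕ := ofBits (fun c => cle c p) 64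
/-- Mask of the cells comparable with `p`. [this work] -/
def cmpMask (p : ℕ) : ℕ := ofBits (fun c => cle c p || cle p c) 64
/-- `|↓p|`, the key by which the points of an antichain are ordered (largest first). [this work] -/
def dsize (p : ℕ) : ℕ := (cx p + 1) * (cy p + 1) * (cz p + 1)
/-- The cells of `↓p`, increasing. [this work] -/
def downCells (p : ℕ) : List ℕ := (List.range 64).filter fun c => cle c p

/-! ### The 24 permutations of `{0,1,2,3}` (lexicographic) and the 576 Latin transversals -/

/-- `S_4` as lists, lexicographic. [this work] -/
def permL : List (List ℕ) :=
  [[0,1,2,3],[0,1,3,2],[0,2,1,3],[0,2,3,1],[0,3,1,2],[0,3,2,1],[1,0,2,3],[1,0,3,2],[1,2,0,3],[1,2,3,0],[1,3,0,2],[1,3,2,0],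
   [2,0,1,3],[2,0,3,1],[2,1,0,3],[2,1,3,0],[2,3,0,1],[2,3,1,0],[3,0,1,2],[3,0,2,1],[3,1,0,2],[3,1,2,0],[3,2,0,1],[3,2,1,0]]
/-- `S_4` flattened: entry `4k + j` = `π_k(j)`. [this work] -/
def pmTab : Array ℕ := (permL.map List.toArray).toArray.flatten
/-- The `k`-th permutation applied to `j`. [this work] -/
def pm (k j : ℕ) : ℕ := pmTab.getD (4 * k + j) 0
/-- Cell number `j` (the one with `x = j`) of the transversal `L = 24a + b`: `(j, π_a j, π_b j)`. [this work] -/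
def transCell (L j : ℕ) : ℕ := 16 * j + 4 * pm (L / 24) j + pm (L % 24) j
/-- The (packed, `4L + j`) list of the transversals through the cell `y` with the position of `y` in them. [this work] -/
def tyList (y : ℕ) : List ℕ := (List.range 2304).filter fun e => transCell (e / 4) (e % 4) == y

/-! ### The order-4 kernel on 16-bit patterns and the table `Ψ` -/

/-- Entry `(i,c)` of the pattern `m` (bit `4i + c`) as an integer. [this work] -/
def bt (m i c : ℕ) : ℤ := if m.testBit (4 * i + c) then 1 else 0
/-- `K₄` — prim-sahi's `copyKernel_four` polynomial, read on a 16-bit pattern. [this work] -/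
def k4 (m : ℕ) : ℤ :=
  6 * (bt m 0 3 * bt m 1 3 * bt m 2 3 * bt m 3 3)
  - 2 * (bt m 1 3 * bt m 2 3 * bt m 3 3 * bt m 0 0 + bt m 0 3 * bt m 2 3 * bt m 3 3 * bt m 1 1 + bt m 0 3 * bt m 1 3 * bt m 3 3 * bt m 2 2
          + bt m 0 2 * bt m 1 2 * bt m 2 2 * bt m 3 3)
  - (bt m 0 1 * bt m 1 1 * (bt m 2 3 * bt m 3 3) + bt m 0 2 * bt m 2 2 * (bt m 1 3 * bt m 3 3) + bt m 0 3 * bt m 3 3 * (bt m 1 2 * bt m 2 2))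
  + (bt m 0 1 * bt m 1 1 * bt m 2 2 * bt m 3 3 + bt m 0 2 * bt m 2 2 * bt m 1 1 * bt m 3 3 + bt m 0 3 * bt m 3 3 * bt m 1 1 * bt m 2 2
      + bt m 1 2 * bt m 2 2 * bt m 0 0 * bt m 3 3 + bt m 1 3 * bt m 3 3 * bt m 0 0 * bt m 2 2 + bt m 2 3 * bt m 3 3 * bt m 0 0 * bt m 1 1)
  - bt m 0 0 * bt m 1 1 * bt m 2 2 * bt m 3 3
/-- Column relabelling of a pattern: `(colPerm r m) i c = m i (π_r c)`. [this work] -/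
def colPerm (r m : ℕ) : ℕ := ofBits (fun b => m.testBit (4 * (b / 4) + pm r (b % 4))) 16
/-- `Ψ(M) = Σ_{ρ ∈ S_4} K₄(M ∘ ρ)`: the contribution of one unordered transversal with incidence pattern `M` (the specification). [this work] -/
def psiSlow (m : ℕ) : ℤ := ((List.range 24).map fun r => k4 (colPerm r m)).sum
/-- The one-hot pattern with row `i` = `{j_i}`, `j = 64 j₀ + 16 j₁ + 4 j₂ + j₃`. [this work] -/
def oneHot (j : ℕ) : ℕ := 2 ^ (j / 64) + 2 ^ (4 + j / 16 % 4) + 2 ^ (8 + j / 4 % 4) + 2 ^ (12 + j % 4)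
/-- The tensor of `Ψ`: its values on the `256` one-hot patterns. [this work] -/
def psiT : Array ℤ := Array.ofFn (n := 256) fun j => psiSlow (oneHot j.val)
/-- Sum of `f j` over the set bits `j < 4` of row `i` of `m`. [this work] -/
def rowSum (m i : ℕ) (f : ℕ → ℤ) : ℤ :=
  (if m.testBit (4 * i) then f 0 else 0) + (if m.testBit (4 * i + 1) then f 1 else 0) +
    (if m.testBit (4 * i + 2) then f 2 else 0) + (if m.testBit (4 * i + 3) then f 3 else 0)
/-- `Ψ` evaluated by multilinearity from its tensor (fast form used to build the table; `= psiSlow`, companion file). [this work] -/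
def psi (T : Array ℤ) (m : ℕ) : ℤ :=
  rowSum m 0 fun j0 => rowSum m 1 fun j1 => rowSum m 2 fun j2 => rowSum m 3 fun j3 => T.getD (64 * j0 + 16 * j1 + 4 * j2 + j3) 0
/-- The table of `Ψ` on all `2^16` patterns. [this work] -/
def psiTab : Array ℤ := let T := psiT; Array.ofFn (n := 65536) fun m => psi T m.val
/-- The increment table: `ctTab[16m + b] = Ψ(m) − Ψ(m − 2^b)` when bit `b` of `m` is set (else `0`). [this work] -/
def ctTab : Array ℤ := let P := psiTab; Array.ofFn (n := 65536 * 16) fun e =>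
  if (e.val / 16).testBit (e.val % 16) then P.getD (e.val / 16) 0 - P.getD (e.val / 16 - 2 ^ (e.val % 16)) 0 else 0

/-! ### Antichains of `[4]^3`; axis-canonical representatives -/

/-- Table of the comparability masks. [this work] -/
def cmpTab : Array ℕ := Array.ofFn (n := 64) fun p => cmpMask p.val
/-- All antichains extending `cur` by cells `≥ c` (depth-first; `k` = number of cells still to decide; `T` = `cmpTab`). [this work] -/
def acGo (T : Array ℕ) : ℕ → ℕ → ℕ → List ℕ
  | 0, _, cur => [cur]
  | k + 1, c, cur => acGo T k (c + 1) cur ++ (if cur &&& T.getD c 0 == 0 then acGo T k (c + 1) (cur ||| 2 ^ c) else [])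
/-- The list of all antichains of `[4]^3` (as masks); `232 848` of them. [this work] -/
def acList : List ℕ := acGo cmpTab 64 0 0
/-- The cells of a mask, increasing. [this work] -/
def cellsOf (m : ℕ) : List ℕ := (List.range 64).filter fun c => m.testBit c
/-- The six coordinate permutations. [this work] -/
def axL : List (List ℕ) := [[0,1,2],[0,2,1],[1,0,2],[1,2,0],[2,0,1],[2,1,0]]
/-- Coordinate `a ∈ {0,1,2}` of a cell. [this work] -/
def coord (c a : ℕ) : ℕ := if a = 0 then cx c else if a = 1 then cy c else cz c
/-- The cell whose coordinates are those of `c` read through the `s`-th coordinate permutation. [this work] -/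
def axCell (s c : ℕ) : ℕ :=
  16 * coord c ((axL.getD s []).getD 0 0) + 4 * coord c ((axL.getD s []).getD 1 0) + coord c ((axL.getD s []).getD 2 0)
/-- Table of `axCell`: entry `64 s + c`. [this work] -/
def axTab : Array ℕ := Array.ofFn (n := 6 * 64) fun e => axCell (e.val / 64) (e.val % 64)
/-- The image mask `{axCell s c : c ∈ cells}` (`A` = `axTab`). [this work] -/
def axImg (A : Array ℕ) (s : ℕ) (cells : List ℕ) : ℕ := cells.foldl (fun acc c => acc ||| (1 <<< A.getD (64 * s + c) 0)) 0
/-- Canonical = minimal among its six axis images. [this work] -/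
def isCanon (A : Array ℕ) (m : ℕ) : Bool := let cs := cellsOf m; (List.range 6).all fun s => decide (m ≤ axImg A s cs)
/-- The `40 238` axis-canonical antichains. [this work] -/
def canonList : List ℕ := let A := axTab; acList.filter (isCanon A)

/-! ### The colouring DFS with incrementally maintained transversal patterns -/

/-- Read-only tables threaded through the search. [this work] -/
structure Ctx where
  /-- `ty[4y + i]` = the 36 packed updates `16 L + (4i + j)` over the transversals `L` through `y` (`transCell L j = y`) -/
  ty : Array (List ℕ)
  /-- increments `Ψ(m) − Ψ(m − 2^b)` at `16m + b` -/
  ct : Array ℤ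
  /-- `dc[p]` = cells of `↓p` -/
  dc : Array (List ℕ)
  /-- `dm[p]` = mask of `↓p` -/
  dm : Array ℕ

/-- The tables. [this work] -/
def mkCtx : Ctx where
  ty := Array.ofFn (n := 256) fun t => (tyList (t.val / 4)).map fun e => 16 * (e / 4) + (4 * (t.val % 4) + e % 4)
  ct := ctTab
  dc := Array.ofFn (n := 64) fun p => downCells p.val
  dm := Array.ofFn (n := 64) fun p => downMask p.val

/-- Search state: down-masks of the four colour classes, the 576 patterns, the current `Φ`. [this work] -/
structure St where
  /-- `ds[i]` = mask of `↓N_i` -/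
  ds : Vector ℕ 4
  /-- `pats[L]` = incidence pattern of the transversal `L` -/
  pats : Vector ℕ 576
  /-- `Φ` of the current family -/
  phi : ℤ

/-- Run a list of pattern updates `e = 16L + b` (the transversal `L` loses the bit `b`; `Φ` moves by `−(Ψ(m) − Ψ(m − 2^b))`). [this work] -/
def cellLoop (C : Ctx) : List ℕ → Vector ℕ 576 → ℤ → Vector ℕ 576 × ℤ
  | [], pats, phi => (pats, phi)
  | e :: es, pats, phi =>
      if h : e / 16 < 576 then
        let m := pats[e / 16]
        cellLoop C es (pats.set (e / 16) (m - (1 <<< (e % 16))) h) (phi - C.ct.getD (m * 16 + e % 16) 0)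
      else cellLoop C es pats phi
/-- Remove the listed cells from member `i` (each: the 36 transversals through it), skipping cells already outside it
(`dmask` = its down-mask). [this work] -/
def downLoop (C : Ctx) (i dmask : ℕ) : List ℕ → Vector ℕ 576 → ℤ → Vector ℕ 576 × ℤ
  | [], pats, phi => (pats, phi)
  | y :: ys, pats, phi =>
      if dmask.testBit y then downLoop C i dmask ys pats phi
      else
        let r := cellLoop C (C.ty.getD (4 * y + i) []) pats phi
        downLoop C i dmask ys r.1 r.2
/-- Give the point `p` the colour `i`: member `i` loses the cells of `↓p` it still has. [this work] -/
def applyDown (C : Ctx) (i p : ℕ) (s : St) : St :=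
  if hi : i < 4 then
    let dmask := s.ds[i]
    let r := downLoop C i dmask (C.dc.getD p []) s.pats s.phi
    ⟨s.ds.set i (dmask ||| C.dm.getD p 0) hi, r.1, r.2⟩
  else s
/-- Depth-first over the restricted-growth colourings of the remaining points (`nc` colours used so far); every leaf must have `Φ ≥ 0`.
[this work] -/
def colGo (C : Ctx) : List ℕ → ℕ → St → Bool
  | [], _, s => decide (0 ≤ s.phi)
  | p :: rest, nc, s => (List.range (min (nc + 1) 4)).all fun i => colGo C rest (max nc (i + 1)) (applyDown C i p s)
/-- The points of an antichain mask, largest down-set first. [this work] -/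
def ptsOf (m : ℕ) : List ℕ := ((List.range 64).filter fun c => m.testBit c).mergeSort fun a b => decide (dsize b ≤ dsize a)
/-- The start: all members are the whole cube, all patterns full, `Φ = 0`. [this work] -/
def initSt : St := ⟨Vector.replicate 4 0, Vector.replicate 576 65535, 0⟩
/-- Check one antichain mask. [this work] -/
def checkMask (C : Ctx) (m : ℕ) : Bool := colGo C (ptsOf m) 0 initSt
/-- **The certificate predicate**: the canonical antichains with indices in `[lo, lo + n)` pass. [this work] -/
def checkRange (lo n : ℕ) : Bool :=
  let C := mkCtx
  let arr := canonList.toArray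
  (List.range' lo n).all fun a => checkMask C (arr.getD a 0)

/-- Statistics twin of `colGo` (leaf count, number of leaves with `Φ = 0`, `Σ Φ`), for cross-checks against external engines. [this work] -/
def colStat (C : Ctx) : List ℕ → ℕ → St → ℕ × ℕ × ℤ → ℕ × ℕ × ℤ
  | [], _, s, acc => (acc.1 + 1, acc.2.1 + (if s.phi = 0 then 1 else 0), acc.2.2 + s.phi)
  | p :: rest, nc, s, acc => (List.range (min (nc + 1) 4)).foldl (fun acc i => colStat C rest (max nc (i + 1)) (applyDown C i p s) acc) acc
/-- Statistics over a range of canonical antichains. [this work] -/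
def statRange (lo n : ℕ) : ℕ × ℕ × ℤ :=
  let C := mkCtx
  let arr := canonList.toArray
  (List.range' lo n).foldl (fun acc a => colStat C (ptsOf (arr.getD a 0)) 0 initSt acc) (0, 0, 0)

/-! ### Sanity checks (computational) -/

/-- `232 848` antichains of `[4]^3` (= MacMahon's number of plane partitions in the `4×4×4` box). [this work] -/
theorem acList_length : acList.length = 232848 := by native_decide

/-- `40 238` of them are axis-canonical. [this work] -/
theorem canonList_length : canonList.length = 40238 := by native_decide

/-- `Ψ` vanishes on the full pattern (a transversal inside all four members contributes nothing). [this work] -/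
theorem psiSlow_full : psiSlow 65535 = 0 := by native_decide

/-- Smoke test of the search on the first canonical antichains. [this work] -/
theorem checkRange_smoke : checkRange 0 64 = true := by native_decide

/-- Cross-check with the seat's C engine on the first `2000` canonical antichains: `231 929` leaves, `2 106` of them with `Φ = 0`, `Σ Φ = 949 422 858`
(identical figures from `proto34.c`). [this work] -/
theorem statRange_2000 : statRange 0 2000 = (231929, 2106, 949422858) := by native_decide

end SahiSlot34

end Summit.CriticalPhenomena.PercolationContinuityZ3.Theorems
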